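import Mathlib
import Summits.NavierStokesRegularity.NavierStokesRegularity.Theorems.L3TimeExponentPincerRingDatumVelocity
import Summits.NavierStokesRegularity.NavierStokesRegularity.Theorems.L3TimeExponentPincerRingDatumPolarBall
import Summits.NavierStokesRegularity.NavierStokesRegularity.Theorems.L3TimeExponentPincerRingDatumSpeedBound
import HarnessLib.Audit
import HarnessLib

/-!
# L3TimeExponentPincer — ring datum calculus XIII: pointwise energy floor on the polar ball

Support kernel for the crux `L3CascadeJaw` (item stmt-NavierStokesRegularity-19499): on the polar
test ball `B = ball ((17ℓ/10)e₂) (ℓ/10)` (`…RingDatumPolarBall`: `2ℓ² ≤ |x|² ≤ 4ℓ²`,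
`x₀² + x₁² ≤ |x|²/4`) the ring field `u₀ = curl (F(|x|²) J)` of a profile with
`F'(s) = −κ s^{-5/2}` and `F(s) ≥ (2κ/3)(s^{-3/2} − b^{-3/2})` on the dipole zone `2ℓ² ≤ s ≤ 4ℓ²`,
`b ≥ 64ℓ²`, satisfies `‖u₀(x)‖² ≥ (4κ²/9)/(4ℓ²)³ = κ²/(144 ℓ⁶)` (`norm_ringField_sq_ge_on_polarBall`);
with `ofReal_le_lintegral_of_le_on_ball` this is the hypothesis `ofReal E ≤ ∫⁻ ‖u₀‖ₑ²` of
`lpPersistence_of_ringData` with `E = κ²ℓ^{-6}/144 · (ℓ/10)³ · V₁`.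
WHAT THIS IS NOT: real arithmetic on top of tree lemmas.
-/

namespace Summit.NavierStokesRegularity.NavierStokesRegularity.Theorems.L3TimeExponentPincerRingDatumEnergyFloor

open Real Set Metric Literature.Analysis.FluidPDE
open Summit.NavierStokesRegularity.NavierStokesRegularity.Theorems.L3TimeExponentPincerRingDatumVelocity
open Summit.NavierStokesRegularity.NavierStokesRegularity.Theorems.L3TimeExponentPincerRingDatumPolarBall
open Summit.NavierStokesRegularity.NavierStokesRegularity.Theorems.L3TimeExponentPincerRingDatumSpeedBound

/-- If `0 < s` and `4s ≤ b` then `b^{-3/2} ≤ s^{-3/2}/8`. -/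
theorem rpow_neg_three_halves_le_div_eight {s b : ℝ} (hs : 0 < s) (hsb : 4 * s ≤ b) :
    b ^ (-(3 / 2 : ℝ)) ≤ s ^ (-(3 / 2 : ℝ)) / 8 := by
  have hb : 0 < b := by linarith
  have h1 : b ^ (-(3 / 2 : ℝ)) ≤ (4 * s) ^ (-(3 / 2 : ℝ)) :=
    Real.rpow_le_rpow_of_nonpos (by positivity) hsb (by norm_num)
  have h2 : (4 * s) ^ (-(3 / 2 : ℝ)) = s ^ (-(3 / 2 : ℝ)) / 8 := by
    rw [Real.mul_rpow (by norm_num) hs.le]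
    have : (4 : ℝ) ^ (-(3 / 2 : ℝ)) = 1 / 8 := by
      rw [show (4 : ℝ) = 2 ^ (2 : ℝ) by norm_num, ← Real.rpow_mul (by norm_num)]
      norm_num
    rw [this]
    ring
  exact h1.trans h2.le

variable {F : ℝ → ℝ} {κ b ℓ : ℝ}

/-- **Pointwise energy floor on the polar ball.**  If `F` is differentiable with
`F'(s) = −κ s^{-5/2}` and `F(s) ≥ (2κ/3)(s^{-3/2} − b^{-3/2})` for `2ℓ² ≤ s ≤ 4ℓ²`, `0 ≤ κ`,
`0 < ℓ`, `16ℓ² ≤ b`, then on `ball ((17ℓ/10)e₂) (ℓ/10)`: `κ²/(144 ℓ⁶) ≤ ‖u₀(x)‖²`. -/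
theorem norm_ringField_sq_ge_on_polarBall (hF : Differentiable ℝ F) (hκ : 0 ≤ κ) (hℓ : 0 < ℓ)
    (hb : 16 * ℓ ^ 2 ≤ b)
    (hF' : ∀ s ∈ Icc (2 * ℓ ^ 2) (4 * ℓ ^ 2), deriv F s = -κ * s ^ (-(5 / 2 : ℝ)))
    (hFge : ∀ s ∈ Icc (2 * ℓ ^ 2) (4 * ℓ ^ 2),
      (2 * κ / 3) * (s ^ (-(3 / 2 : ℝ)) - b ^ (-(3 / 2 : ℝ))) ≤ F s)
    {x : EuclideanSpace ℝ (Fin 3)}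
    (hx : x ∈ ball (EuclideanSpace.single (2 : Fin 3) (17 * ℓ / 10) : EuclideanSpace ℝ (Fin 3)) (ℓ / 10)) :
    κ ^ 2 / (144 * ℓ ^ 6) ≤
      ‖curl (fun y : EuclideanSpace ℝ (Fin 3) => F (‖y‖ ^ 2) • rotGen y) x‖ ^ 2 := by
  have hs2 := polarBall_norm_sq_ge hℓ hx
  have hs4 := polarBall_norm_sq_le hℓ hx
  have hcyl := polarBall_cyl_sq_le hℓ hx
  set s := ‖x‖ ^ 2 with hs_def
  have hs0 : 0 < s := by nlinarith
  have hmem : s ∈ Icc (2 * ℓ ^ 2) (4 * ℓ ^ 2) := ⟨hs2, hs4⟩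
  have hax := axial_factor_ge (ρ := x 0 ^ 2 + x 1 ^ 2) hκ hs0 (hF' s hmem) (hFge s hmem) hcyl
    (rpow_neg_three_halves_le_div_eight hs0 (by nlinarith))
  -- `κ s^{-3/2}/3 ≤ F + ρ F'`, both sides: square (LHS ≥ 0)
  have hL : 0 ≤ κ * s ^ (-(3 / 2 : ℝ)) / 3 := by positivity
  have hsq : (κ * s ^ (-(3 / 2 : ℝ)) / 3) ^ 2 ≤ (F s + (x 0 ^ 2 + x 1 ^ 2) * deriv F s) ^ 2 :=
    pow_le_pow_left₀ hL hax 2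
  have hge := norm_ringField_sq_ge hF x
  rw [← hs_def] at hge
  -- `(κ s^{-3/2}/3)² = κ²/(9 s³) ≥ κ²/(9 (4ℓ²)³)`
  have h3 : (κ * s ^ (-(3 / 2 : ℝ)) / 3) ^ 2 = κ ^ 2 * (s ^ 3)⁻¹ / 9 := by
    rw [div_pow, mul_pow, rpow_neg_three_halves_sq hs0]; ring
  have h4 : ((4 * ℓ ^ 2) ^ 3)⁻¹ ≤ (s ^ 3)⁻¹ := by
    apply inv_anti₀ (pow_pos hs0 3)
    exact pow_le_pow_left₀ hs0.le hs4 3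
  have h5 : κ ^ 2 / (144 * ℓ ^ 6) = 4 * (κ ^ 2 * ((4 * ℓ ^ 2) ^ 3)⁻¹ / 9) := by
    field_simp
    ring
  rw [h5]
  calc 4 * (κ ^ 2 * ((4 * ℓ ^ 2) ^ 3)⁻¹ / 9) ≤ 4 * (κ ^ 2 * (s ^ 3)⁻¹ / 9) := by
        gcongr
    _ = 4 * (κ * s ^ (-(3 / 2 : ℝ)) / 3) ^ 2 := by rw [h3]
    _ ≤ 4 * (F s + (x 0 ^ 2 + x 1 ^ 2) * deriv F s) ^ 2 := by gcongr
    _ ≤ _ := hge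

end Summit.NavierStokesRegularity.NavierStokesRegularity.Theorems.L3TimeExponentPincerRingDatumEnergyFloor
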